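import Literature.Probability.Percolation.ConditionalPositiveAssociationProofs
import Literature.Probability.Percolation.PercolationProofs
import HarnessLib

/-!
# CELL-PA: inside a red cell the blue cluster of `x` is conditionally positively associated given `z ∉ C_x`
# (van den Berg–Häggström–Kahn's Theorem 1.3 transported into the coefficientwise / two-colouring world)

Support file (`--supports stmt-CriticalPhenomena-4575`, closed), prover `prim-lf-2` (gen 32).  No definitions, no named facts,
no sorries; standard axioms.  Memos `prim-lf-2/CW-VDBHK-gen29.md` §8.3/§8.7 (the design: "CELL-PA — a TRUE coefficientwise theorem,
provable now") and `prim-lf-2/CW-POINTS-gen32.md` §5.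

Setting.  In prim-lf-2's coefficientwise programme (CW-PROGRAMME-gen21) a colouring of the edge set `ι` of a finite graph
`ends : ι → Sym2 V` is a finite set `s` of RED edges, `sᶜ` being BLUE; `C_x(·) = openCluster (ends '' ·) x`.  Conditioning the
first-rung sum `T = Σ_S Δf·Δg` on the RED CELL of `x` (its red cluster `K` together with the red edges inside it) leaves a
sub-cube of colourings: a set `B₀` of surely-blue edges (the boundary of `K` and the non-red edges inside `K`), a set `E₁` of free
edges (those off `K`), all other edges red; the blue cluster of `x` is then `L(t) = C_x(B₀ ∪ t)`, `t ⊆ E₁` uniform, and the wall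
`z ∉ C_x(sᶜ)` becomes `z ∉ L(t)` (memo CW-VDBHK-gen29 §8.3: "the blue world B(𝒦) is a PRODUCT measure … so V_𝒦 ≥ 0 IS
van den Berg–Häggström–Kahn's Theorem 1.3 at p ∈ {0, ½, 1}").  This file proves exactly that engine statement, for every
sub-cube `(B₀, E₁)` of a simple graph (`ends` injective):

* `Coefficientwise.cell_conditionalPA` — **CELL-PA**: for monotone `f, g : Set V → ℝ`, `D = {t ⊆ E₁ : z ∉ L(t)}`,
  `(Σ_{t∈D} f(L t))·(Σ_{t∈D} g(L t)) ≤ |D| · Σ_{t∈D} f(L t)·g(L t)`,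
  i.e. under the uniform colouring of the free edges, conditioned on `z ∉ C_x`, the (blue) cluster of `x` is positively associated.
* `Coefficientwise.cell_cov_form` — the form used by the MEANS-K reduction (memo §8.3): for any constants `a, b`,
  `|D| · Σ_{t∈D} (a − f(L t))(b − g(L t)) ≥ (Σ_{t∈D} (a − f(L t)))·(Σ_{t∈D} (b − g(L t)))`
  (with `a = f(K)`, `b = g(K)` the left side is `|D|` times the cell's contribution to `T`, the right side `|D|²·Y_f·Y_g`).
Tools (reusable): `Coefficientwise.mem_openCluster_iff_edgeCluster` (vertex cluster = `x` plus the ends of BHK's edge cluster) and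
`Coefficientwise.sum_weight_subcube` (the `{0, ½, 1}`-weighted BHK sum over `Set (Sym2 V)` is `2^{-|E₁|}` times the sum over the sub-cube).
Proof of CELL-PA: `Literature.Probability.Percolation.BHK2006.core` (the tree's PROVED finite-sum form of BHK Thm. 1.1/1.3) with
`U = univ`, `X = Y = {z}`, weights `w = 1` on `ends '' B₀`, `½` on `ends '' E₁`, `0` elsewhere, and `F = f ∘ vertices − f {x}`.
Multigraphs reduce to this case by merging parallel classes (not done here).
[cite: VandenbergHaggstromKahn2005, Thm. 1.3 (p. 6) with Thm. 1.1 (pp. 3–5)]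
-/

noncomputable section

open Finset
open Literature.Probability.Percolation
open Literature.Probability.Percolation.BHK2006
open DecisionTree (ind ind_of_mem ind_of_not_mem ind_nonneg)

namespace Summit.CriticalPhenomena.PercolationContinuityZ3.Theorems

namespace Coefficientwise

open scoped Classical

variable {V : Type*}

/-- The vertex cluster of `x` is `x` together with the end-points of van den Berg–Häggström–Kahn's EDGE cluster of `x`.
[cite: VandenbergHaggstromKahn2005, §1 p. 3 (definition of `C_s`)] -/
theorem mem_openCluster_iff_edgeCluster (ω : Set (Sym2 V)) (x v : V) :
    v ∈ openCluster ω x ↔ v = x ∨ ∃ e ∈ openEdgeCluster ω x, v ∈ e := by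
  constructor
  · intro hv
    have hr : (openGraph ω).Reachable x v := hv
    obtain ⟨p⟩ := hr
    cases hp : p.reverse with
    | nil => exact Or.inl rfl
    | @cons _ u _ hadj q =>
      right
      have hux : (openGraph ω).Reachable x u := ⟨q.reverse⟩
      have hadj' : (openGraph ω).Adj u v := hadj.symm
      rw [openGraph_adj] at hadj'
      refine ⟨s(u, v), ?_, Sym2.mem_mk_right u v⟩
      rw [mem_openEdgeCluster_iff]
      refine ⟨hadj'.1, ?_, ?_⟩
      · rw [Sym2.mk_isDiag_iff]; exact hadj'.2
      · intro y hy
        rw [Sym2.mem_iff] at hy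
        rcases hy with rfl | rfl
        · exact hux
        · exact hv
  · rintro (rfl | ⟨e, he, hve⟩)
    · exact mem_openCluster_self ω v
    · exact ((mem_openEdgeCluster_iff ω x e).1 he).2.2 v hve

/-- Set form of `mem_openCluster_iff_edgeCluster`: `C_x(ω) = {v | v = x ∨ ∃ e ∈ C^edge_x(ω), v ∈ e}`.
[cite: VandenbergHaggstromKahn2005, §1 p. 3 (definition of `C_s`)] -/
theorem openCluster_eq_verts_edgeCluster (ω : Set (Sym2 V)) (x : V) :
    openCluster ω x = {v | v = x ∨ ∃ e ∈ openEdgeCluster ω x, v ∈ e} :=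
  Set.ext fun v => mem_openCluster_iff_edgeCluster ω x v

section Subcube

variable {ι : Type*} [DecidableEq ι] [Fintype V] [DecidableEq V]

/-- **The sub-cube bridge.**  For a simple graph `ends : ι → Sym2 V` (injective), disjoint edge sets `B₀` (surely open) and `E₁`
(free), and the product weight `w = 1` on `ends '' B₀`, `½` on `ends '' E₁`, `0` elsewhere, the BHK weighted sum over all pair
configurations `ω : Set (Sym2 V)` equals `2^{-|E₁|}` times the plain sum over the sub-cube `{ends '' (B₀ ∪ t) : t ⊆ E₁}`.
[cite: VandenbergHaggstromKahn2005, §1 p. 2 (bond percolation with arbitrary edge probabilities `p_e`)] -/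
theorem sum_weight_subcube (ends : ι → Sym2 V) (hinj : Function.Injective ends) (B₀ E₁ : Finset ι)
    (hdis : Disjoint B₀ E₁) (φ : Set (Sym2 V) → ℝ) :
    ∑ ω : Set (Sym2 V), weight (fun e => if e ∈ B₀.image ends then (1 : ℝ) else if e ∈ E₁.image ends then 1 / 2 else 0) ω
        * φ ω
      = (1 / 2 : ℝ) ^ E₁.card * ∑ t ∈ E₁.powerset, φ (↑((B₀ ∪ t).image ends) : Set (Sym2 V)) := by
  set w : Sym2 V → ℝ := fun e => if e ∈ B₀.image ends then (1 : ℝ) else if e ∈ E₁.image ends then 1 / 2 else 0 with hw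
  set Ω : Finset ι → Set (Sym2 V) := fun t => (↑((B₀ ∪ t).image ends) : Set (Sym2 V)) with hΩ
  -- membership in `Ω t`
  have memΩ : ∀ (t : Finset ι) (e : Sym2 V), e ∈ Ω t ↔ ∃ i ∈ B₀ ∪ t, ends i = e := by
    intro t e
    simp only [hΩ, Finset.coe_image, Set.mem_image, Finset.mem_coe]
  -- images of `B₀` and `E₁` are disjoint
  have notE₁_of_B₀ : ∀ e : Sym2 V, e ∈ B₀.image ends → e ∉ E₁.image ends := by
    intro e he he'
    obtain ⟨i, hi, rfl⟩ := Finset.mem_image.1 he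
    obtain ⟨j, hj, hji⟩ := Finset.mem_image.1 he'
    have : j = i := hinj hji
    subst this
    exact Finset.disjoint_left.1 hdis hi hj
  -- Step 1: the weight of a sub-cube point
  have hval : ∀ t, t ⊆ E₁ → weight w (Ω t) = (1 / 2 : ℝ) ^ E₁.card := by
    intro t ht
    have hprod : weight w (Ω t) = ∏ e : Sym2 V, (if e ∈ E₁.image ends then (1 / 2 : ℝ) else 1) := by
      unfold weight
      refine Finset.prod_congr rfl fun e _ => ?_
      by_cases h1 : e ∈ B₀.image ends
      · have heΩ : e ∈ Ω t := by
          obtain ⟨i, hi, rfl⟩ := Finset.mem_image.1 h1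
          exact (memΩ t _).2 ⟨i, Finset.mem_union_left _ hi, rfl⟩
        have hwe : w e = 1 := by simp only [hw, h1, if_true]
        have hn : e ∉ E₁.image ends := notE₁_of_B₀ e h1
        rw [if_pos heΩ, if_neg hn, hwe]
      · by_cases h2 : e ∈ E₁.image ends
        · have hwe : w e = 1 / 2 := by simp only [hw, h1, h2, if_true, if_false]
          rw [if_pos h2]
          by_cases heΩ : e ∈ Ω t
          · rw [if_pos heΩ, hwe]
          · rw [if_neg heΩ, hwe]; norm_num
        · have hwe : w e = 0 := by simp only [hw, h1, h2, if_false]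
          have heΩ : e ∉ Ω t := by
            intro he
            obtain ⟨i, hi, rfl⟩ := (memΩ t _).1 he
            rcases Finset.mem_union.1 hi with hiB | hit
            · exact h1 (Finset.mem_image_of_mem ends hiB)
            · exact h2 (Finset.mem_image_of_mem ends (ht hit))
          rw [if_neg heΩ, hwe, if_neg h2]; norm_num
    rw [hprod, Finset.prod_ite_mem, Finset.univ_inter, Finset.prod_const, Finset.card_image_of_injective _ hinj]
  -- Step 2: the weight vanishes off the sub-cube
  have hzero : ∀ ω : Set (Sym2 V), ω ∉ (E₁.powerset).image Ω → weight w ω = 0 := by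
    intro ω hω
    by_contra hne
    apply hω
    have hfac : ∀ e : Sym2 V, (if e ∈ ω then w e else 1 - w e) ≠ 0 := by
      intro e
      have := Finset.prod_ne_zero_iff.1 (by unfold weight at hne; exact hne) e (Finset.mem_univ e)
      exact this
    set t : Finset ι := E₁.filter (fun i => ends i ∈ ω) with ht
    refine Finset.mem_image.2 ⟨t, Finset.mem_powerset.2 (Finset.filter_subset _ _), ?_⟩
    ext e
    constructor
    · intro he
      obtain ⟨i, hi, rfl⟩ := (memΩ t e).1 he
      rcases Finset.mem_union.1 hi with hiB | hit
      · have h1 : ends i ∈ B₀.image ends := Finset.mem_image_of_mem ends hiB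
        by_contra hni
        have := hfac (ends i)
        rw [if_neg hni] at this
        apply this
        simp only [hw, h1, if_true, sub_self]
      · exact (Finset.mem_filter.1 hit).2
    · intro he
      have hfe := hfac e
      rw [if_pos he] at hfe
      by_cases h1 : e ∈ B₀.image ends
      · obtain ⟨i, hi, rfl⟩ := Finset.mem_image.1 h1
        exact (memΩ t _).2 ⟨i, Finset.mem_union_left _ hi, rfl⟩
      · by_cases h2 : e ∈ E₁.image ends
        · obtain ⟨j, hj, rfl⟩ := Finset.mem_image.1 h2
          exact (memΩ t _).2 ⟨j, Finset.mem_union_right _ (Finset.mem_filter.2 ⟨hj, he⟩), rfl⟩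
        · exact absurd (by simp only [hw, h1, h2, if_false]) hfe
  -- Step 3: `Ω` is injective on the sub-cube
  have hΩinj : Set.InjOn Ω ↑(E₁.powerset) := by
    intro t₁ ht₁ t₂ ht₂ h
    have ht₁' : t₁ ⊆ E₁ := Finset.mem_powerset.1 ht₁
    have ht₂' : t₂ ⊆ E₁ := Finset.mem_powerset.1 ht₂
    have key : ∀ {a b : Finset ι}, a ⊆ E₁ → Ω a = Ω b → a ⊆ b := by
      intro a b ha hab i hi
      have : ends i ∈ Ω b := by rw [← hab]; exact (memΩ a _).2 ⟨i, Finset.mem_union_right _ hi, rfl⟩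
      obtain ⟨j, hj, hji⟩ := (memΩ b _).1 this
      have : j = i := hinj hji
      subst this
      rcases Finset.mem_union.1 hj with hjB | hjb
      · exact absurd (ha hi) (Finset.disjoint_left.1 hdis hjB)
      · exact hjb
    exact Finset.Subset.antisymm (key ht₁' h) (key ht₂' h.symm)
  -- assemble
  calc ∑ ω : Set (Sym2 V), weight w ω * φ ω
      = ∑ ω ∈ (E₁.powerset).image Ω, weight w ω * φ ω := by
        symm
        refine Finset.sum_subset (Finset.subset_univ _) fun ω _ hω => ?_
        rw [hzero ω hω, zero_mul]
    _ = ∑ t ∈ E₁.powerset, weight w (Ω t) * φ (Ω t) := Finset.sum_image hΩinj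
    _ = ∑ t ∈ E₁.powerset, (1 / 2 : ℝ) ^ E₁.card * φ (Ω t) :=
        Finset.sum_congr rfl fun t ht => by rw [hval t (Finset.mem_powerset.1 ht)]
    _ = (1 / 2 : ℝ) ^ E₁.card * ∑ t ∈ E₁.powerset, φ (Ω t) := by rw [Finset.mul_sum]

/-- **CELL-PA (van den Berg–Häggström–Kahn's Theorem 1.3 inside a cell of the two-colouring cube).**  Simple graph `ends : ι → Sym2 V`
(injective), vertices `x, z`, disjoint edge sets `B₀` (surely blue) and `E₁` (free), `L(t) = C_x(B₀ ∪ t)` the (blue) cluster of `x`,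
`D = {t ⊆ E₁ : z ∉ L(t)}`.  For monotone `f, g : Set V → ℝ`,
  `(Σ_{t∈D} f(L t))·(Σ_{t∈D} g(L t)) ≤ |D| · Σ_{t∈D} f(L t)·g(L t)`:
conditioned on `z ∉ C_x`, the cluster of `x` under the uniform colouring of the free edges is positively associated.  This is the
engine `V_𝒦 ≥ 0` of prim-lf-2's MEANS-K split (memo CW-VDBHK-gen29 §8.3), i.e. BHK's theorem at `p_e ∈ {0, ½, 1}`, obtained from
the tree's proved finite-sum form `BHK2006.core` (`U = univ`, `X = Y = {z}`) through `sum_weight_subcube`.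
[cite: VandenbergHaggstromKahn2005, Thm. 1.3 (p. 6) with Thm. 1.1 (pp. 3–5)] -/
theorem cell_conditionalPA (ends : ι → Sym2 V) (hinj : Function.Injective ends) (x z : V) (B₀ E₁ : Finset ι)
    (hdis : Disjoint B₀ E₁) (f g : Set V → ℝ) (hf : Monotone f) (hg : Monotone g) :
    (∑ t ∈ E₁.powerset.filter (fun t => z ∉ openCluster (ends '' (↑(B₀ ∪ t) : Set ι)) x),
        f (openCluster (ends '' (↑(B₀ ∪ t) : Set ι)) x)) *
      (∑ t ∈ E₁.powerset.filter (fun t => z ∉ openCluster (ends '' (↑(B₀ ∪ t) : Set ι)) x),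
        g (openCluster (ends '' (↑(B₀ ∪ t) : Set ι)) x)) ≤
    ((E₁.powerset.filter (fun t => z ∉ openCluster (ends '' (↑(B₀ ∪ t) : Set ι)) x)).card : ℝ) *
      ∑ t ∈ E₁.powerset.filter (fun t => z ∉ openCluster (ends '' (↑(B₀ ∪ t) : Set ι)) x),
        f (openCluster (ends '' (↑(B₀ ∪ t) : Set ι)) x) * g (openCluster (ends '' (↑(B₀ ∪ t) : Set ι)) x) := by
  -- notation
  set L : Finset ι → Set V := fun t => openCluster (ends '' (↑(B₀ ∪ t) : Set ι)) x with hL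
  set D : Finset (Finset ι) := E₁.powerset.filter (fun t => z ∉ L t) with hD
  change (∑ t ∈ D, f (L t)) * (∑ t ∈ D, g (L t)) ≤ (D.card : ℝ) * ∑ t ∈ D, f (L t) * g (L t)
  -- the trivial case `x = z` (then `D = ∅`)
  by_cases hxz : x = z
  · subst hxz
    have hDe : D = ∅ := by
      refine Finset.filter_false_of_mem fun t _ => ?_
      simp only [hL, not_not]
      exact mem_openCluster_self _ x
    simp [hDe]
  -- the product weight of the sub-cube and its basic properties
  set w : Sym2 V → ℝ := fun e => if e ∈ B₀.image ends then (1 : ℝ) else if e ∈ E₁.image ends then 1 / 2 else 0 with hw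
  have hw0 : ∀ e, 0 ≤ w e := fun e => by
    simp only [hw]; split_ifs <;> norm_num
  have hw1 : ∀ e, w e ≤ 1 := fun e => by
    simp only [hw]; split_ifs <;> norm_num
  set Ω : Finset ι → Set (Sym2 V) := fun t => (↑((B₀ ∪ t).image ends) : Set (Sym2 V)) with hΩ
  have hΩL : ∀ t, openCluster (Ω t) x = L t := fun t => by
    simp only [hΩ, hL, Finset.coe_image]
  set c : ℝ := (1 / 2 : ℝ) ^ E₁.card with hc
  have hcpos : 0 < c := by positivity
  have bridge : ∀ φ : Set (Sym2 V) → ℝ, ∑ ω : Set (Sym2 V), weight w ω * φ ω = c * ∑ t ∈ E₁.powerset, φ (Ω t) :=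
    fun φ => sum_weight_subcube ends hinj B₀ E₁ hdis φ
  have hm : ∑ ω : Set (Sym2 V), weight w ω = 1 := by
    have h1 := bridge fun _ => (1 : ℝ)
    simp only [mul_one, Finset.sum_const, Finset.card_powerset, nsmul_eq_mul] at h1
    rw [h1, hc]
    push_cast
    rw [← mul_pow]; norm_num
  -- `U = univ`: restricted cluster / disconnection are the plain ones
  have hE : ∀ ω : Set (Sym2 V), ω ∩ edgesIn (Finset.univ : Finset V) = ω := fun ω => by
    ext e
    simp only [Set.mem_inter_iff, edgesIn, Set.mem_setOf_eq, Finset.mem_univ, imp_true_iff, and_true]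
  have hC : ∀ ω, rC Finset.univ x ω = openEdgeCluster ω x := fun ω => by simp only [rC, hE]
  have hDD : ∀ ω, ω ∈ rD Finset.univ x ({z} : Set V) ↔ z ∉ openCluster ω x := fun ω => by
    simp only [rD, hE, Set.mem_setOf_eq, Set.mem_singleton_iff, forall_eq, openCluster]
  -- the shifted functions of the edge cluster
  set vx : Set (Sym2 V) → Set V := fun C => {v | v = x ∨ ∃ e ∈ C, v ∈ e} with hvx
  have hvx_mono : Monotone vx := fun C C' hCC' v hv => by
    rcases hv with hv | ⟨e, he, hve⟩
    · exact Or.inl hv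
    · exact Or.inr ⟨e, hCC' he, hve⟩
  have hx_vx : ∀ C, ({x} : Set V) ⊆ vx C := fun C v hv => Or.inl hv
  have hvx_cl : ∀ ω : Set (Sym2 V), vx (openEdgeCluster ω x) = openCluster ω x := fun ω =>
    (openCluster_eq_verts_edgeCluster ω x).symm
  set F' : Set (Sym2 V) → ℝ := fun C => f (vx C) - f {x} with hF'
  set G' : Set (Sym2 V) → ℝ := fun C => g (vx C) - g {x} with hG'
  have hF'm : Monotone F' := fun C C' h => sub_le_sub_right (hf (hvx_mono h)) _
  have hG'm : Monotone G' := fun C C' h => sub_le_sub_right (hg (hvx_mono h)) _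
  have hF'0 : ∀ C, 0 ≤ F' C := fun C => sub_nonneg.2 (hf (hx_vx C))
  have hG'0 : ∀ C, 0 ≤ G' C := fun C => sub_nonneg.2 (hg (hx_vx C))
  -- BHK Theorem 1.1 / 1.3 in finite-sum form, `U = univ`, `X = Y = {z}`
  have hzU : ({z} : Set V) ⊆ ↑(Finset.univ : Finset V) := by simp
  have key := core w hw0 hw1 hm Finset.univ x (Finset.mem_univ x) {z} {z} hzU hzU F' G' hF'm hG'm hF'0 hG'0
  rw [Set.inter_self, Set.union_self] at key
  simp only [hC] at key
  -- evaluate the four weighted sums on the sub-cube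
  set D' : Set (Set (Sym2 V)) := rD Finset.univ x ({z} : Set V) with hD'
  have hind : ∀ t, ind D' (Ω t) = if z ∉ L t then 1 else 0 := fun t => by
    by_cases h : z ∉ L t
    · rw [if_pos h, ind_of_mem ((hDD (Ω t)).2 (by rw [hΩL]; exact h))]
    · rw [if_neg h, ind_of_not_mem (fun hm' => h (by rw [← hΩL]; exact (hDD (Ω t)).1 hm'))]
  have hF'Ω : ∀ t, F' (openEdgeCluster (Ω t) x) = f (L t) - f {x} := fun t => by
    simp only [hF', hvx_cl, hΩL]
  have hG'Ω : ∀ t, G' (openEdgeCluster (Ω t) x) = g (L t) - g {x} := fun t => by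
    simp only [hG', hvx_cl, hΩL]
  have ev : ∀ h : Finset ι → ℝ,
      ∑ t ∈ E₁.powerset, h t * (if z ∉ L t then (1 : ℝ) else 0) = ∑ t ∈ D, h t := fun h => by
    rw [hD, Finset.sum_filter]
    exact Finset.sum_congr rfl fun t _ => by split_ifs <;> simp
  have s1 : ∑ ω : Set (Sym2 V), weight w ω * (F' (openEdgeCluster ω x) * ind D' ω) = c * ∑ t ∈ D, (f (L t) - f {x}) := by
    rw [bridge, ← ev (fun t => f (L t) - f {x})]
    congr 1
    exact Finset.sum_congr rfl fun t _ => by rw [hF'Ω, hind]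
  have s2 : ∑ ω : Set (Sym2 V), weight w ω * (G' (openEdgeCluster ω x) * ind D' ω) = c * ∑ t ∈ D, (g (L t) - g {x}) := by
    rw [bridge, ← ev (fun t => g (L t) - g {x})]
    congr 1
    exact Finset.sum_congr rfl fun t _ => by rw [hG'Ω, hind]
  have s3 : ∑ ω : Set (Sym2 V), weight w ω * (F' (openEdgeCluster ω x) * G' (openEdgeCluster ω x) * ind D' ω)
      = c * ∑ t ∈ D, (f (L t) - f {x}) * (g (L t) - g {x}) := by
    rw [bridge, ← ev (fun t => (f (L t) - f {x}) * (g (L t) - g {x}))]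
    congr 1
    exact Finset.sum_congr rfl fun t _ => by rw [hF'Ω, hG'Ω, hind]
  have s4 : ∑ ω : Set (Sym2 V), weight w ω * ind D' ω = c * (D.card : ℝ) := by
    rw [bridge]
    congr 1
    have : ∑ t ∈ E₁.powerset, ind D' (Ω t) = ∑ t ∈ E₁.powerset, (1 : ℝ) * (if z ∉ L t then (1 : ℝ) else 0) :=
      Finset.sum_congr rfl fun t _ => by rw [hind, one_mul]
    rw [this, ev (fun _ => (1 : ℝ)), Finset.sum_const, nsmul_eq_mul, mul_one]
  rw [s1, s2, s3, s4] at key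
  -- remove the common factor `c² > 0` and un-shift
  set N : ℝ := (D.card : ℝ) with hN
  set Sf := ∑ t ∈ D, f (L t) with hSf
  set Sg := ∑ t ∈ D, g (L t) with hSg
  set Sfg := ∑ t ∈ D, f (L t) * g (L t) with hSfg
  have e1 : ∑ t ∈ D, (f (L t) - f {x}) = Sf - N * f {x} := by
    rw [Finset.sum_sub_distrib, Finset.sum_const, nsmul_eq_mul]
  have e2 : ∑ t ∈ D, (g (L t) - g {x}) = Sg - N * g {x} := by
    rw [Finset.sum_sub_distrib, Finset.sum_const, nsmul_eq_mul]
  have e3 : ∑ t ∈ D, (f (L t) - f {x}) * (g (L t) - g {x}) = Sfg - f {x} * Sg - g {x} * Sf + N * (f {x} * g {x}) := by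
    have : ∀ t, (f (L t) - f {x}) * (g (L t) - g {x})
        = f (L t) * g (L t) - f {x} * g (L t) - g {x} * f (L t) + f {x} * g {x} := fun t => by ring
    simp only [this, Finset.sum_add_distrib, Finset.sum_sub_distrib, ← Finset.mul_sum, Finset.sum_const, nsmul_eq_mul]
    rw [hSfg, hSf, hSg, hN]; ring
  rw [e1, e2, e3] at key
  have key' : (Sf - N * f {x}) * (Sg - N * g {x}) ≤ (Sfg - f {x} * Sg - g {x} * Sf + N * (f {x} * g {x})) * N := by
    have hcc : 0 < c * c := mul_pos hcpos hcpos
    have : c * c * ((Sf - N * f {x}) * (Sg - N * g {x}))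
        ≤ c * c * ((Sfg - f {x} * Sg - g {x} * Sf + N * (f {x} * g {x})) * N) := by nlinarith [key]
    exact le_of_mul_le_mul_left this hcc
  have iden : (Sf - N * f {x}) * (Sg - N * g {x}) - (Sfg - f {x} * Sg - g {x} * Sf + N * (f {x} * g {x})) * N
      = Sf * Sg - N * Sfg := by ring
  linarith [key', iden]

/-- **The covariance form of CELL-PA used by the MEANS-K split** (memo CW-VDBHK-gen29 §8.3): in the notation of `cell_conditionalPA`,
for all constants `a, b` (in the application `a = f(K)`, `b = g(K)` with `K` the red cluster of the cell),
  `(Σ_{t∈D} (a − f(L t)))·(Σ_{t∈D} (b − g(L t))) ≤ |D| · Σ_{t∈D} (a − f(L t))·(b − g(L t))`,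
i.e. the cell's contribution to the first-rung sum `T = Σ_S Δf·Δg` is at least `|D|·Y_f·Y_g` (`Y_f = a −` cell average of `f(L)`).
[cite: VandenbergHaggstromKahn2005, Thm. 1.3 (p. 6)] -/
theorem cell_cov_form (ends : ι → Sym2 V) (hinj : Function.Injective ends) (x z : V) (B₀ E₁ : Finset ι)
    (hdis : Disjoint B₀ E₁) (f g : Set V → ℝ) (hf : Monotone f) (hg : Monotone g) (a b : ℝ) :
    (∑ t ∈ E₁.powerset.filter (fun t => z ∉ openCluster (ends '' (↑(B₀ ∪ t) : Set ι)) x),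
        (a - f (openCluster (ends '' (↑(B₀ ∪ t) : Set ι)) x))) *
      (∑ t ∈ E₁.powerset.filter (fun t => z ∉ openCluster (ends '' (↑(B₀ ∪ t) : Set ι)) x),
        (b - g (openCluster (ends '' (↑(B₀ ∪ t) : Set ι)) x))) ≤
    ((E₁.powerset.filter (fun t => z ∉ openCluster (ends '' (↑(B₀ ∪ t) : Set ι)) x)).card : ℝ) *
      ∑ t ∈ E₁.powerset.filter (fun t => z ∉ openCluster (ends '' (↑(B₀ ∪ t) : Set ι)) x),
        (a - f (openCluster (ends '' (↑(B₀ ∪ t) : Set ι)) x)) * (b - g (openCluster (ends '' (↑(B₀ ∪ t) : Set ι)) x)) := by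
  have key := cell_conditionalPA ends hinj x z B₀ E₁ hdis f g hf hg
  set L : Finset ι → Set V := fun t => openCluster (ends '' (↑(B₀ ∪ t) : Set ι)) x with hL
  set D : Finset (Finset ι) := E₁.powerset.filter (fun t => z ∉ L t) with hD
  change (∑ t ∈ D, f (L t)) * (∑ t ∈ D, g (L t)) ≤ (D.card : ℝ) * ∑ t ∈ D, f (L t) * g (L t) at key
  change (∑ t ∈ D, (a - f (L t))) * (∑ t ∈ D, (b - g (L t))) ≤ (D.card : ℝ) * ∑ t ∈ D, (a - f (L t)) * (b - g (L t))
  set N : ℝ := (D.card : ℝ) with hN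
  set Sf := ∑ t ∈ D, f (L t) with hSf
  set Sg := ∑ t ∈ D, g (L t) with hSg
  set Sfg := ∑ t ∈ D, f (L t) * g (L t) with hSfg
  have e1 : ∑ t ∈ D, (a - f (L t)) = N * a - Sf := by
    rw [Finset.sum_sub_distrib, Finset.sum_const, nsmul_eq_mul]
  have e2 : ∑ t ∈ D, (b - g (L t)) = N * b - Sg := by
    rw [Finset.sum_sub_distrib, Finset.sum_const, nsmul_eq_mul]
  have e3 : ∑ t ∈ D, (a - f (L t)) * (b - g (L t)) = N * (a * b) - a * Sg - b * Sf + Sfg := by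
    have : ∀ t, (a - f (L t)) * (b - g (L t)) = a * b - a * g (L t) - b * f (L t) + f (L t) * g (L t) := fun t => by ring
    simp only [this, Finset.sum_add_distrib, Finset.sum_sub_distrib, ← Finset.mul_sum, Finset.sum_const, nsmul_eq_mul]
    rw [hSfg, hSf, hSg, hN]; ring
  rw [e1, e2, e3]
  have iden : (N * a - Sf) * (N * b - Sg) - N * (N * (a * b) - a * Sg - b * Sf + Sfg) = Sf * Sg - N * Sfg := by ring
  linarith [key, iden]

end Subcube

end Coefficientwise

end Summit.CriticalPhenomena.PercolationContinuityZ3.Theorems
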